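import Literature.NumberTheory.EllipticCurves.DiscreteH1Equiv
import Literature.NumberTheory.EllipticCurves.SelmerCorankProofs
import Literature.NumberTheory.EllipticCurves.SelmerUnramified
import HarnessLib

/-!
# Corestriction along an open subgroup of index `2` on continuous `H¹`; the `±`-decomposition

Generic continuous group cohomology (no number theory), on the tree's model of
`H¹_cont(G, M)` for a topological group `G` and a discrete `G`-module `M`
(`Literature.NumberTheory.EllipticCurves.discreteH1`, explicit cocycles
`Literature.NumberTheory.GaloisRepresentations.contOneCocycles` / `oneCocycleClass` of file
`GaloisRepresentations/ContinuousH1`, restriction `resH1Hom`, conjugation `conjH1` of file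
`SubgroupSelmer`). For an open normal subgroup `N ≤ G` of index `2` with `G = N ⊔ N c`:

* `liftH1` — homomorphisms out of `H¹_cont(G, M)` defined on cocycles and killing coboundaries;
* `corCocycle`, `corH1` — the **corestriction** `H¹(N, M) → H¹(G, M)`, by the explicit index-`2`
  transfer formula on crossed homomorphisms `F(n) = f(n) + c • f(c⁻¹ n c)`,
  `F(n c) = F(n) + n • f(c²)` (`n ∈ N`);
* `resSubgroupH1_corH1` — `res ∘ cor = 1 + c_*` (`c_*` the conjugation action `conjH1 N M c`);
  `corH1_resSubgroupH1` — `cor ∘ res = 2`; `conjH1_resSubgroupH1` — `c_* ∘ res = res`;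
* `h1EquivSubgroup_conjH1_neg` — for a second discrete `G`-module `M'` and an additive
  isomorphism `ψ : M' ≃ M` which is `N`-equivariant and *anti*-equivariant at `c`
  (`ψ (c • m') = -(c • ψ m')`), the induced `ψ_* : H¹(N, M') ≃ H¹(N, M)` satisfies
  `ψ_* ∘ c_* = -c_* ∘ ψ_*`;
* `IndexTwoDecompositionData.nsmul_ker`, `….nsmul_mem_range` — the **`±`-decomposition up to
  bounded torsion**: for subgroups `S ≤ H¹(G, M)`, `S' ≤ H¹(G, M')`, `T ≤ H¹(N, M)` with
  `res S ⊆ T`, `ψ_* res S' ⊆ T`, `c_* T ⊆ T` and "`res η ∈ T ⇒ 2^a η ∈ S`" (and likewise for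
  `S'`), the map `Φ : S × S' → T`, `(η, η') ↦ res η + ψ_* res η'` has kernel killed by `4` and
  `2^(a+1) T ⊆ im Φ`.

This is the cohomological mechanism behind `Sel_{p^∞}(E/K(√α))` versus
`Sel_{p^∞}(E/K) ⊕ Sel_{p^∞}(E_α/K)` (Dokchitser–Dokchitser, Ann. of Math. 172 (2010), proof of
Lemma 4.14: restriction to an index-`|G|` subgroup has kernel and cokernel killed by `|G|²`;
T. Dokchitser, *Notes on the parity conjecture* (2013), §4: `E_α ≅ E` over `K(√α)` with the
Galois action twisted by the quadratic character). Everything here is proved.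

## References

* J.-P. Serre, *Galois Cohomology* (1997), I.§2.4 (res, cor, `cor ∘ res = (G : H)`), I.§5.8.
  [SerreGaloisCohomology1997]
* J. Neukirch, A. Schmidt, K. Wingberg, *Cohomology of Number Fields*, 2nd ed. (2008), I.§5
  (corestriction on cochains, conjugation). [NeukirchSchmidtWingberg2008]
* T. Dokchitser, V. Dokchitser, Ann. of Math. 172 (2010), Lemma 4.14 (proof).
  [DokchitserDokchitserAnnals2010]
-/

noncomputable section

open scoped Classical

universe u

namespace Literature.NumberTheory.EllipticCurves

open GaloisRepresentations

variable {G : Type u} [Group G] [TopologicalSpace G] [IsTopologicalGroup G]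

/-! ## Homomorphisms out of `H¹` via cocycles -/

section LiftH1

variable {M : Type u} [AddCommGroup M] [DistribMulAction G M] [TopologicalSpace M]
  [DiscreteTopology M]
variable {X : Type*} [AddCommGroup X]

variable (G M) in
/-- The class map `Z¹_cont(G, M) → H¹_cont(G, M)` as an additive homomorphism. [folklore] -/
abbrev classHom : contOneCocycles (discreteTopRep G M) →+ discreteH1 G M :=
  (oneCocycleClassₗ (discreteTopRep G M)).toAddMonoidHom

/-- `classHom` is `oneCocycleClass`. [folklore] -/
@[simp]
theorem classHom_apply (f : contOneCocycles (discreteTopRep G M)) :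
    classHom G M f = oneCocycleClass (discreteTopRep G M) f :=
  rfl

/-- `classHom` is onto (`oneCocycleClass_surjective`). [folklore] -/
theorem classHom_surjective : Function.Surjective (classHom G M) :=
  oneCocycleClass_surjective _

/-- **Maps out of `H¹` defined on cocycles.** An additive map on continuous crossed
homomorphisms that kills those with trivial class descends to `H¹_cont(G, M) = Z¹/B¹`.
Serre, *Galois Cohomology*, I.§2.2. [folklore] -/
def liftH1 (φ : contOneCocycles (discreteTopRep G M) →+ X)
    (hφ : ∀ f, oneCocycleClass (discreteTopRep G M) f = 0 → φ f = 0) : discreteH1 G M →+ X :=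
  (QuotientAddGroup.lift (classHom G M).ker φ fun f hf ↦ hφ f hf).comp
    (QuotientAddGroup.quotientKerEquivOfSurjective (classHom G M)
      classHom_surjective).symm.toAddMonoidHom

/-- `liftH1 φ [f] = φ f`. [folklore] -/
@[simp]
theorem liftH1_oneCocycleClass (φ : contOneCocycles (discreteTopRep G M) →+ X)
    (hφ : ∀ f, oneCocycleClass (discreteTopRep G M) f = 0 → φ f = 0)
    (f : contOneCocycles (discreteTopRep G M)) :
    liftH1 φ hφ (oneCocycleClass (discreteTopRep G M) f) = φ f := by
  unfold liftH1
  rw [AddMonoidHom.coe_comp, Function.comp_apply, AddEquiv.coe_toAddMonoidHom]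
  have e : (QuotientAddGroup.quotientKerEquivOfSurjective (classHom G M) classHom_surjective)
      (QuotientAddGroup.mk f) = oneCocycleClass (discreteTopRep G M) f := rfl
  rw [← e, AddEquiv.symm_apply_apply]
  rfl

end LiftH1

/-- `[-φ] = -[φ]`. [folklore] -/
theorem oneCocycleClass_neg' {H : Type u} [Group H] [TopologicalSpace H] [IsTopologicalGroup H]
    {M : Type u} [AddCommGroup M] [DistribMulAction H M] [TopologicalSpace M] [DiscreteTopology M]
    (φ : contOneCocycles (discreteTopRep H M)) :
    oneCocycleClass (discreteTopRep H M) (-φ) = -oneCocycleClass (discreteTopRep H M) φ :=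
  (oneCocycleClassₗ (discreteTopRep H M)).map_neg φ

/-! ## Cocycle calculus on a subgroup -/

section Cocycles

variable (N : Subgroup G)
variable {M : Type u} [AddCommGroup M] [DistribMulAction G M] [TopologicalSpace M]
  [DiscreteTopology M]

omit [IsTopologicalGroup G] in
/-- The crossed-homomorphism identity on `N`, with the action written in `G`. [folklore] -/
theorem cocycle_mul (f : contOneCocycles (discreteTopRep N M)) (a b : N) :
    f.1 (a * b) = f.1 a + (a : G) • f.1 b :=
  f.2 a b

omit [IsTopologicalGroup G] in
/-- `f 1 = 0`. [folklore] -/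
theorem cocycle_one (f : contOneCocycles (discreteTopRep N M)) : f.1 1 = 0 :=
  contOneCocycles.apply_one f

omit [IsTopologicalGroup G] in
/-- `f a⁻¹ = -(a⁻¹ • f a)`. [folklore] -/
theorem cocycle_inv (f : contOneCocycles (discreteTopRep N M)) (a : N) :
    f.1 a⁻¹ = -(((a⁻¹ : N) : G) • f.1 a) := by
  have h := cocycle_mul N f a⁻¹ a
  rw [inv_mul_cancel, cocycle_one] at h
  rw [eq_neg_iff_add_eq_zero]
  exact h.symm

omit [IsTopologicalGroup G] in
/-- The crossed-homomorphism identity on `G`. [folklore] -/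
theorem cocycle_mul' (f : contOneCocycles (discreteTopRep G M)) (a b : G) :
    f.1 (a * b) = f.1 a + a • f.1 b :=
  f.2 a b

omit [IsTopologicalGroup G] in
/-- `f a⁻¹ = -(a⁻¹ • f a)` on `G`. [folklore] -/
theorem cocycle_inv' (f : contOneCocycles (discreteTopRep G M)) (a : G) :
    f.1 a⁻¹ = -(a⁻¹ • f.1 a) := by
  have h := cocycle_mul' f a⁻¹ a
  rw [inv_mul_cancel, contOneCocycles.apply_one] at h
  rw [eq_neg_iff_add_eq_zero]
  exact h.symm

/-- Pointwise addition of cocycles. [folklore] -/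
theorem add_apply_val {H : Type u} [Group H] [TopologicalSpace H] [DistribMulAction H M]
    (f g : contOneCocycles (discreteTopRep H M)) (x : H) : (f + g).1 x = f.1 x + g.1 x :=
  rfl

/-- Pointwise subtraction of cocycles. [folklore] -/
theorem sub_apply_val {H : Type u} [Group H] [TopologicalSpace H] [DistribMulAction H M]
    (f g : contOneCocycles (discreteTopRep H M)) (x : H) : (f - g).1 x = f.1 x - g.1 x :=
  rfl

/-- Pointwise scalar multiples of cocycles. [folklore] -/
theorem nsmul_apply_val {H : Type u} [Group H] [TopologicalSpace H] [DistribMulAction H M]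
    (k : ℕ) (f : contOneCocycles (discreteTopRep H M)) (x : H) : (k • f).1 x = k • f.1 x :=
  rfl

variable (M) in
/-- Restriction `H¹_cont(G, M) → H¹_cont(N, M)` to a subgroup (the pair `(N ↪ G, id_M)`;
`Literature.NumberTheory.EllipticCurves.resH1Hom` along `subgroupIncl`). Serre, *Galois
Cohomology*, I.§2.4. [folklore] -/
def resSubgroupH1 : discreteH1 G M →+ subgroupH1 N M :=
  resH1Hom (subgroupIncl N) (AddMonoidHom.id M) fun _ _ ↦ rfl

/-- Restriction of a continuous crossed homomorphism to `N`. [folklore] -/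
def resCocycle (f : contOneCocycles (discreteTopRep G M)) :
    contOneCocycles (discreteTopRep N M) :=
  contOneCocycles.pullback (subgroupIncl N)
    (resHomOfEquivariant (subgroupIncl N) (AddMonoidHom.id M) fun _ _ ↦ rfl) f

omit [IsTopologicalGroup G] in
/-- Values of the restricted cocycle. [folklore] -/
@[simp]
theorem resCocycle_apply (f : contOneCocycles (discreteTopRep G M)) (n : N) :
    (resCocycle N f).1 n = f.1 n :=
  rfl

/-- `res [f] = [f|_N]`. [folklore] -/
theorem resSubgroupH1_oneCocycleClass (f : contOneCocycles (discreteTopRep G M)) :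
    resSubgroupH1 N M (oneCocycleClass (discreteTopRep G M) f) =
      oneCocycleClass (discreteTopRep N M) (resCocycle N f) :=
  map_oneCocycleClass (X := discreteTopRep G M) (Y := discreteTopRep N M) (subgroupIncl N)
    (resHomOfEquivariant (subgroupIncl N) (AddMonoidHom.id M) fun _ _ ↦ rfl) f

variable [N.Normal]

/-- The conjugate `(c · f)(n) = c • f(c⁻¹ n c)` of a continuous crossed homomorphism on the normal
subgroup `N` (the pair `(n ↦ c⁻¹ n c, m ↦ c • m)` of `Literature.NumberTheory.EllipticCurves.conjH1`).
Serre, *Galois Cohomology*, I.§2.5; Neukirch–Schmidt–Wingberg, I.§5. [folklore] -/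
def conjCocycle (c : G) (f : contOneCocycles (discreteTopRep N M)) :
    contOneCocycles (discreteTopRep N M) :=
  contOneCocycles.pullback (subgroupConj N c)
    (resHomOfEquivariant (subgroupConj N c) (DistribSMul.toAddMonoidHom M c) fun x m ↦ by
      simp only [DistribSMul.toAddMonoidHom_apply, Subgroup.smul_def, subgroupConj_apply_coe,
        smul_smul, mul_assoc, mul_inv_cancel_left]) f

/-- Values of the conjugated cocycle. [folklore] -/
@[simp]
theorem conjCocycle_apply (c : G) (f : contOneCocycles (discreteTopRep N M)) (n : N) :
    (conjCocycle N c f).1 n = c • f.1 (subgroupConj N c n) :=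
  rfl

/-- `c_* [f] = [c · f]` for the conjugation action `conjH1 N M c` on `H¹(N, M)`. [folklore] -/
theorem conjH1_oneCocycleClass (c : G) (f : contOneCocycles (discreteTopRep N M)) :
    conjH1 N M c (oneCocycleClass (discreteTopRep N M) f) =
      oneCocycleClass (discreteTopRep N M) (conjCocycle N c f) :=
  map_oneCocycleClass (X := discreteTopRep N M) (Y := discreteTopRep N M) (subgroupConj N c)
    (resHomOfEquivariant (subgroupConj N c) (DistribSMul.toAddMonoidHom M c) fun x m ↦ by
      simp only [DistribSMul.toAddMonoidHom_apply, Subgroup.smul_def, subgroupConj_apply_coe,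
        smul_smul, mul_assoc, mul_inv_cancel_left]) f

/-- **Conjugation acts trivially on restricted classes**: `c_* (res η) = res η`. On cocycles,
`c • f(c⁻¹ n c) - f(n) = n • f(c) - f(c)` is the coboundary of `f(c)`.
Serre, *Galois Cohomology*, I.§2.5; *Local Fields*, VII.§5, Prop. 3. [folklore] -/
theorem conjH1_resSubgroupH1 (hM : ∀ m : M, Continuous fun g : G ↦ g • m) (c : G)
    (η : discreteH1 G M) : conjH1 N M c (resSubgroupH1 N M η) = resSubgroupH1 N M η := by
  obtain ⟨f, rfl⟩ := oneCocycleClass_surjective _ η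
  rw [resSubgroupH1_oneCocycleClass, conjH1_oneCocycleClass, ← sub_eq_zero,
    ← oneCocycleClass_sub]
  have hcont : Continuous fun n : N ↦ n • f.1 c :=
    (hM (f.1 c)).comp continuous_subtype_val
  have key : conjCocycle N c (resCocycle N f) - resCocycle N f = cobCocycle (f.1 c) hcont := by
    apply Subtype.ext
    ext n
    rw [sub_apply_val, cobCocycle_apply, conjCocycle_apply, resCocycle_apply, resCocycle_apply,
      subgroupConj_apply_coe, cocycle_mul' f (c⁻¹ * n) c, cocycle_mul' f c⁻¹ n, cocycle_inv' f c,
      Subgroup.smul_def]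
    simp only [smul_add, smul_neg, smul_smul, mul_inv_cancel, one_smul, mul_inv_cancel_left]
    abel
  rw [key]
  exact oneCocycleClass_cobCocycle _ _

end Cocycles

/-! ## The index-`2` transfer on cocycles -/

section Transfer

variable {N : Subgroup G} [N.Normal] {c : G}
variable {M : Type u} [AddCommGroup M] [DistribMulAction G M] [TopologicalSpace M]
  [DiscreteTopology M]

omit [TopologicalSpace G] [IsTopologicalGroup G] [N.Normal] in
/-- From `G = N ⊔ N c` (as `Xor`): `c ∉ N`. [folklore] -/
theorem not_mem_of_xor (hc : ∀ b : G, Xor (b * c⁻¹ ∈ N) (b ∈ N)) : c ∉ N := fun h ↦ by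
  rcases hc c with ⟨-, h2⟩ | ⟨-, h2⟩
  · exact h2 h
  · exact h2 (by rw [mul_inv_cancel]; exact N.one_mem)

omit [TopologicalSpace G] [IsTopologicalGroup G] [N.Normal] in
/-- From `G = N ⊔ N c`: an element outside `N` lies in `N c`. [folklore] -/
theorem mul_inv_mem_of_not_mem (hc : ∀ b : G, Xor (b * c⁻¹ ∈ N) (b ∈ N)) {g : G}
    (hg : g ∉ N) : g * c⁻¹ ∈ N := by
  rcases hc g with ⟨h1, -⟩ | ⟨h1, -⟩
  · exact h1
  · exact absurd h1 hg

omit [TopologicalSpace G] [IsTopologicalGroup G] [N.Normal] in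
/-- From `G = N ⊔ N c`: `c² ∈ N`. [folklore] -/
theorem mul_self_mem_of_xor (hc : ∀ b : G, Xor (b * c⁻¹ ∈ N) (b ∈ N)) : c * c ∈ N := by
  rcases hc (c * c) with ⟨h1, h2⟩ | ⟨h1, -⟩
  · rw [mul_inv_cancel_right] at h1
    exact absurd h1 (not_mem_of_xor hc)
  · exact h1

omit [TopologicalSpace G] [IsTopologicalGroup G] [N.Normal] in
/-- `n c ∉ N` for `n ∈ N`. [folklore] -/
theorem mul_not_mem (hc : ∀ b : G, Xor (b * c⁻¹ ∈ N) (b ∈ N)) (n : N) : (n : G) * c ∉ N :=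
  fun h ↦ not_mem_of_xor hc (by simpa using N.mul_mem (N.inv_mem n.2) h)

omit [TopologicalSpace G] [IsTopologicalGroup G] [N.Normal] in
/-- Every element of `G` is `n` or `n c` with `n ∈ N`. [folklore] -/
theorem exists_eq_or_eq_mul (hc : ∀ b : G, Xor (b * c⁻¹ ∈ N) (b ∈ N)) (g : G) :
    (∃ n : N, g = n) ∨ ∃ n : N, g = n * c := by
  by_cases hg : g ∈ N
  · exact Or.inl ⟨⟨g, hg⟩, rfl⟩
  · exact Or.inr ⟨⟨g * c⁻¹, mul_inv_mem_of_not_mem hc hg⟩, by simp⟩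

variable (c) in
/-- `c n c⁻¹` as an element of the normal subgroup `N`. [folklore] -/
def cConj (n : N) : N := ⟨c * n * c⁻¹, ‹N.Normal›.conj_mem _ n.2 c⟩

omit [TopologicalSpace G] [IsTopologicalGroup G] in
/-- `cConj c n = c n c⁻¹` in `G`. [folklore] -/
@[simp]
theorem cConj_coe (n : N) : ((cConj c n : N) : G) = c * n * c⁻¹ := rfl

/-- `c⁻¹ (c n c⁻¹) c = n`. [folklore] -/
@[simp]
theorem subgroupConj_cConj (n : N) : subgroupConj N c (cConj c n) = n := by
  apply Subtype.ext
  simp [mul_assoc]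

/-- The symmetrised cocycle `f' = f + c · f` on `N`. [folklore] -/
def symCocycle (c : G) (f : contOneCocycles (discreteTopRep N M)) :
    contOneCocycles (discreteTopRep N M) :=
  f + conjCocycle N c f

/-- Values of the symmetrised cocycle. [folklore] -/
@[simp]
theorem symCocycle_apply (f : contOneCocycles (discreteTopRep N M)) (n : N) :
    (symCocycle c f).1 n = f.1 n + c • f.1 (subgroupConj N c n) :=
  rfl

/-- The element `c² ∈ N`. [folklore] -/
def cSq (hc : ∀ b : G, Xor (b * c⁻¹ ∈ N) (b ∈ N)) : N := ⟨c * c, mul_self_mem_of_xor hc⟩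

omit [TopologicalSpace G] [IsTopologicalGroup G] [N.Normal] in
/-- `cSq = c²` in `G`. [folklore] -/
@[simp]
theorem cSq_coe (hc : ∀ b : G, Xor (b * c⁻¹ ∈ N) (b ∈ N)) : ((cSq hc : N) : G) = c * c := rfl

/-- **Key identity** `f'(c n c⁻¹) = c • f'(n) + x - (c n c⁻¹) • x` with `x = f(c²)`, for the
symmetrised cocycle `f' = f + c · f`. [folklore] -/
theorem symCocycle_cConj (hc : ∀ b : G, Xor (b * c⁻¹ ∈ N) (b ∈ N))
    (f : contOneCocycles (discreteTopRep N M)) (n : N) :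
    (symCocycle c f).1 (cConj c n) =
      c • (symCocycle c f).1 n + f.1 (cSq hc) - (c * n * c⁻¹) • f.1 (cSq hc) := by
  -- `c n c⁻¹ = u (c⁻¹ n c) u⁻¹` with `u = c²`
  have hu : cConj c n = cSq hc * subgroupConj N c n * (cSq hc)⁻¹ := by
    apply Subtype.ext
    simp only [cConj_coe, Subgroup.coe_mul, Subgroup.coe_inv, cSq_coe, subgroupConj_apply_coe,
      mul_inv_rev]
    simp only [mul_assoc, mul_inv_cancel_left]
  rw [symCocycle_apply, symCocycle_apply, subgroupConj_cConj, hu, cocycle_mul, cocycle_mul,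
    cocycle_inv]
  simp only [Subgroup.coe_mul, Subgroup.coe_inv, cSq_coe, subgroupConj_apply_coe, smul_add,
    smul_neg, smul_smul, mul_inv_rev]
  simp only [mul_assoc, mul_inv_cancel_left]
  abel

/-- `f'(c²) = x + c • x`. [folklore] -/
theorem symCocycle_cSq (hc : ∀ b : G, Xor (b * c⁻¹ ∈ N) (b ∈ N))
    (f : contOneCocycles (discreteTopRep N M)) :
    (symCocycle c f).1 (cSq hc) = f.1 (cSq hc) + c • f.1 (cSq hc) := by
  have e : subgroupConj N c (cSq hc) = cSq hc := Subtype.ext (by simp)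
  rw [symCocycle_apply, e]

/-- The transfer of `f` to `G` as a bare function: `F(g) = f'(g)` for `g ∈ N` and
`F(g) = f'(g c⁻¹) + (g c⁻¹) • f(c²)` for `g ∉ N`. Neukirch–Schmidt–Wingberg, I.§5
(corestriction on inhomogeneous cochains, transversal `{1, c}`). [folklore] -/
def corFun (hc : ∀ b : G, Xor (b * c⁻¹ ∈ N) (b ∈ N))
    (f : contOneCocycles (discreteTopRep N M)) (g : G) : M :=
  if hg : g ∈ N then (symCocycle c f).1 ⟨g, hg⟩
  else (symCocycle c f).1 ⟨g * c⁻¹, mul_inv_mem_of_not_mem hc hg⟩ + (g * c⁻¹) • f.1 (cSq hc)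

/-- `F` on `N`. [folklore] -/
theorem corFun_coe (hc : ∀ b : G, Xor (b * c⁻¹ ∈ N) (b ∈ N))
    (f : contOneCocycles (discreteTopRep N M)) (n : N) :
    corFun hc f n = (symCocycle c f).1 n := by
  simp [corFun, n.2]

/-- `F` on `N c`. [folklore] -/
theorem corFun_coe_mul (hc : ∀ b : G, Xor (b * c⁻¹ ∈ N) (b ∈ N))
    (f : contOneCocycles (discreteTopRep N M)) (n : N) :
    corFun hc f (n * c) = (symCocycle c f).1 n + (n : G) • f.1 (cSq hc) := by
  rw [corFun, dif_neg (mul_not_mem hc n)]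
  congr 2
  · apply Subtype.ext; simp
  · simp

/-- `F` is continuous (`N` is open, hence so is `N c`; on each coset `F` is continuous).
[folklore] -/
theorem continuous_corFun (hN : IsOpen (N : Set G)) (hM : ∀ m : M, Continuous fun g : G ↦ g • m)
    (hc : ∀ b : G, Xor (b * c⁻¹ ∈ N) (b ∈ N)) (f : contOneCocycles (discreteTopRep N M)) :
    Continuous (corFun hc f) := by
  refine continuous_discrete_rng.2 fun m ↦ ?_
  have hval : Topology.IsOpenEmbedding ((↑) : N → G) := hN.isOpenEmbedding_subtypeVal
  have h1 : IsOpen {n : N | (symCocycle c f).1 n = m} :=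
    (isOpen_discrete {m}).preimage (symCocycle c f).1.continuous
  have hcont2 : Continuous fun n : N ↦ (symCocycle c f).1 n + (n : G) • f.1 (cSq hc) :=
    (symCocycle c f).1.continuous.add ((hM _).comp continuous_subtype_val)
  have h2 : IsOpen {n : N | (symCocycle c f).1 n + (n : G) • f.1 (cSq hc) = m} :=
    (isOpen_discrete {m}).preimage hcont2
  have hset : corFun hc f ⁻¹' {m} =
      ((↑) : N → G) '' {n : N | (symCocycle c f).1 n = m} ∪
        (fun g ↦ g * c) '' (((↑) : N → G) ''
          {n : N | (symCocycle c f).1 n + (n : G) • f.1 (cSq hc) = m}) := by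
    ext g
    simp only [Set.mem_preimage, Set.mem_singleton_iff, Set.mem_union, Set.mem_image,
      Set.mem_setOf_eq]
    constructor
    · intro h
      by_cases hg : g ∈ N
      · refine Or.inl ⟨⟨g, hg⟩, ?_, rfl⟩
        rw [← corFun_coe hc f ⟨g, hg⟩]
        exact h
      · refine Or.inr ⟨g * c⁻¹, ⟨⟨g * c⁻¹, mul_inv_mem_of_not_mem hc hg⟩, ?_, rfl⟩, ?_⟩
        · have e := corFun_coe_mul hc f ⟨g * c⁻¹, mul_inv_mem_of_not_mem hc hg⟩
          rw [Subgroup.coe_mk, inv_mul_cancel_right] at e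
          rw [← e]
          exact h
        · rw [inv_mul_cancel_right]
    · rintro (⟨n, hn, rfl⟩ | ⟨_, ⟨n, hn, rfl⟩, rfl⟩)
      · rw [corFun_coe]
        exact hn
      · rw [corFun_coe_mul]
        exact hn
  rw [hset]
  exact (hval.isOpenMap _ h1).union ((Homeomorph.mulRight c).isOpenMap _ (hval.isOpenMap _ h2))

/-- **The transfer is a crossed homomorphism on `G`.** The four coset cases
`(n₁, n₂), (n₁, n₂c), (n₁c, n₂), (n₁c, n₂c)` of `F(g₁g₂) = F(g₁) + g₁ • F(g₂)`, using
`symCocycle_cConj` and `symCocycle_cSq`. Neukirch–Schmidt–Wingberg, I.§5. [folklore] -/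
theorem corFun_mul (hc : ∀ b : G, Xor (b * c⁻¹ ∈ N) (b ∈ N))
    (f : contOneCocycles (discreteTopRep N M)) (g₁ g₂ : G) :
    corFun hc f (g₁ * g₂) = corFun hc f g₁ + g₁ • corFun hc f g₂ := by
  -- write `gᵢ = nᵢ` or `gᵢ = nᵢ c`
  rcases exists_eq_or_eq_mul hc g₁ with ⟨n₁, rfl⟩ | ⟨n₁, rfl⟩ <;>
    rcases exists_eq_or_eq_mul hc g₂ with ⟨n₂, rfl⟩ | ⟨n₂, rfl⟩
  · -- `(n₁, n₂)`
    rw [← Subgroup.coe_mul, corFun_coe, corFun_coe, corFun_coe, cocycle_mul]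
  · -- `(n₁, n₂ c)`
    rw [← mul_assoc, ← Subgroup.coe_mul, corFun_coe_mul, corFun_coe, corFun_coe_mul, cocycle_mul]
    simp only [Subgroup.coe_mul, smul_add, smul_smul]
    abel
  · -- `(n₁ c, n₂)`: `n₁ c n₂ = (n₁ (c n₂ c⁻¹)) c`
    have e : (n₁ : G) * c * n₂ = ((n₁ * cConj c n₂ : N) : G) * c := by
      simp only [Subgroup.coe_mul, cConj_coe, mul_assoc, inv_mul_cancel, mul_one]
    rw [e, corFun_coe_mul, corFun_coe_mul, corFun_coe, cocycle_mul, symCocycle_cConj hc]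
    simp only [Subgroup.coe_mul, cConj_coe, smul_add, smul_sub, smul_smul]
    simp only [mul_assoc]
    abel
  · -- `(n₁ c, n₂ c)`: `n₁ c n₂ c = n₁ (c n₂ c⁻¹) c²`
    have e : (n₁ : G) * c * (n₂ * c) = ((n₁ * cConj c n₂ * cSq hc : N) : G) := by
      simp only [Subgroup.coe_mul, cConj_coe, cSq_coe, mul_assoc, inv_mul_cancel_left]
    rw [e, corFun_coe, corFun_coe_mul, corFun_coe_mul, cocycle_mul, cocycle_mul,
      symCocycle_cConj hc, symCocycle_cSq hc]
    simp only [Subgroup.coe_mul, cConj_coe, smul_add, smul_sub, smul_smul]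
    simp only [mul_assoc, inv_mul_cancel, mul_one]
    abel

/-- **Corestriction on cocycles** for the open normal subgroup `N` of index `2`: the transfer
`corFun` as a continuous crossed homomorphism `G → M`.
Serre, *Galois Cohomology*, I.§2.4; Neukirch–Schmidt–Wingberg, I.§5. [folklore] -/
def corCocycle (hN : IsOpen (N : Set G)) (hM : ∀ m : M, Continuous fun g : G ↦ g • m)
    (hc : ∀ b : G, Xor (b * c⁻¹ ∈ N) (b ∈ N)) (f : contOneCocycles (discreteTopRep N M)) :
    contOneCocycles (discreteTopRep G M) :=
  ⟨⟨corFun hc f, continuous_corFun hN hM hc f⟩, fun g₁ g₂ ↦ corFun_mul hc f g₁ g₂⟩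

/-- Values of `corCocycle`. [folklore] -/
@[simp]
theorem corCocycle_apply (hN : IsOpen (N : Set G)) (hM : ∀ m : M, Continuous fun g : G ↦ g • m)
    (hc : ∀ b : G, Xor (b * c⁻¹ ∈ N) (b ∈ N)) (f : contOneCocycles (discreteTopRep N M))
    (g : G) : (corCocycle hN hM hc f).1 g = corFun hc f g :=
  rfl

/-! ## Corestriction on `H¹` -/

/-- The symmetrisation is additive. [folklore] -/
theorem symCocycle_add (f₁ f₂ : contOneCocycles (discreteTopRep N M)) :
    symCocycle c (f₁ + f₂) = symCocycle c f₁ + symCocycle c f₂ := by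
  apply Subtype.ext
  ext n
  change f₁.1 n + f₂.1 n + c • (f₁.1 (subgroupConj N c n) + f₂.1 (subgroupConj N c n)) =
    (f₁.1 n + c • f₁.1 (subgroupConj N c n)) + (f₂.1 n + c • f₂.1 (subgroupConj N c n))
  rw [smul_add]
  abel

/-- The transfer is additive. [folklore] -/
theorem corFun_add (hc : ∀ b : G, Xor (b * c⁻¹ ∈ N) (b ∈ N))
    (f₁ f₂ : contOneCocycles (discreteTopRep N M)) (g : G) :
    corFun hc (f₁ + f₂) g = corFun hc f₁ g + corFun hc f₂ g := by
  rcases exists_eq_or_eq_mul hc g with ⟨n, rfl⟩ | ⟨n, rfl⟩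
  · rw [corFun_coe, corFun_coe, corFun_coe, symCocycle_add, add_apply_val]
  · rw [corFun_coe_mul, corFun_coe_mul, corFun_coe_mul, symCocycle_add, add_apply_val,
      add_apply_val, smul_add]
    abel

/-- Corestriction on cocycles as an additive homomorphism `Z¹(N, M) → Z¹(G, M)`. [folklore] -/
def corCocycleHom (hN : IsOpen (N : Set G)) (hM : ∀ m : M, Continuous fun g : G ↦ g • m)
    (hc : ∀ b : G, Xor (b * c⁻¹ ∈ N) (b ∈ N)) :
    contOneCocycles (discreteTopRep N M) →+ contOneCocycles (discreteTopRep G M) :=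
  AddMonoidHom.mk' (corCocycle hN hM hc) fun f₁ f₂ ↦
    Subtype.ext (ContinuousMap.ext fun g ↦ corFun_add hc f₁ f₂ g)

/-- `corCocycleHom` is `corCocycle`. [folklore] -/
@[simp]
theorem corCocycleHom_apply (hN : IsOpen (N : Set G)) (hM : ∀ m : M, Continuous fun g : G ↦ g • m)
    (hc : ∀ b : G, Xor (b * c⁻¹ ∈ N) (b ∈ N)) (f : contOneCocycles (discreteTopRep N M)) :
    corCocycleHom hN hM hc f = corCocycle hN hM hc f :=
  rfl

/-- **Corestriction kills coboundaries**: if `f(n) = n • m - m` on `N` then the transfer of `f`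
is the coboundary of `m + c • m`. [folklore] -/
theorem corFun_of_coboundary (hc : ∀ b : G, Xor (b * c⁻¹ ∈ N) (b ∈ N))
    (f : contOneCocycles (discreteTopRep N M)) (m : M) (hm : ∀ n : N, f.1 n = (n : G) • m - m)
    (g : G) : corFun hc f g = g • (m + c • m) - (m + c • m) := by
  have hsym : ∀ n : N, (symCocycle c f).1 n = (n : G) • (m + c • m) - (m + c • m) := fun n ↦ by
    rw [symCocycle_apply, hm, hm, subgroupConj_apply_coe]
    simp only [smul_sub, smul_add, smul_smul, mul_assoc, mul_inv_cancel_left]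
    abel
  rcases exists_eq_or_eq_mul hc g with ⟨n, rfl⟩ | ⟨n, rfl⟩
  · rw [corFun_coe, hsym]
  · rw [corFun_coe_mul, hsym, hm, cSq_coe]
    simp only [smul_sub, smul_add, smul_smul, mul_assoc]
    abel

/-- **Corestriction** `cor : H¹(N, M) → H¹(G, M)` for the open normal subgroup `N` of index `2`
(`G = N ⊔ N c`), induced by the transfer `corCocycle` (well defined by
`corFun_of_coboundary`). Serre, *Galois Cohomology*, I.§2.4; Neukirch–Schmidt–Wingberg, I.§5.
[folklore] -/
def corH1 (hN : IsOpen (N : Set G)) (hM : ∀ m : M, Continuous fun g : G ↦ g • m)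
    (hc : ∀ b : G, Xor (b * c⁻¹ ∈ N) (b ∈ N)) : subgroupH1 N M →+ discreteH1 G M :=
  liftH1 ((classHom G M).comp (corCocycleHom hN hM hc)) fun f hf ↦ by
    obtain ⟨m, hm⟩ := (oneCocycleClass_eq_zero_iff _ f).mp hf
    rw [AddMonoidHom.coe_comp, Function.comp_apply, corCocycleHom_apply, classHom_apply,
      oneCocycleClass_eq_zero_iff]
    refine ⟨m + c • m, fun g ↦ ?_⟩
    change corFun hc f g = g • (m + c • m) - (m + c • m)
    exact corFun_of_coboundary hc f m (fun n ↦ hm n) g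

/-- `cor [f] = [corCocycle f]`. [folklore] -/
@[simp]
theorem corH1_oneCocycleClass (hN : IsOpen (N : Set G)) (hM : ∀ m : M, Continuous fun g : G ↦ g • m)
    (hc : ∀ b : G, Xor (b * c⁻¹ ∈ N) (b ∈ N)) (f : contOneCocycles (discreteTopRep N M)) :
    corH1 hN hM hc (oneCocycleClass (discreteTopRep N M) f) =
      oneCocycleClass (discreteTopRep G M) (corCocycle hN hM hc f) := by
  rw [corH1, liftH1_oneCocycleClass]
  rfl

/-- **`res ∘ cor = 1 + c_*`**: restricting the transfer back to `N` gives the symmetrisation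
`f + c · f`. (For a general subgroup of finite index, `res ∘ cor` is the sum over double cosets;
Neukirch–Schmidt–Wingberg, I.§5, double coset formula.) [folklore] -/
theorem resSubgroupH1_corH1 (hN : IsOpen (N : Set G)) (hM : ∀ m : M, Continuous fun g : G ↦ g • m)
    (hc : ∀ b : G, Xor (b * c⁻¹ ∈ N) (b ∈ N)) (ξ : subgroupH1 N M) :
    resSubgroupH1 N M (corH1 hN hM hc ξ) = ξ + conjH1 N M c ξ := by
  obtain ⟨f, rfl⟩ := oneCocycleClass_surjective _ ξ
  rw [corH1_oneCocycleClass, resSubgroupH1_oneCocycleClass, conjH1_oneCocycleClass,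
    ← oneCocycleClass_add]
  congr 1
  apply Subtype.ext
  ext n
  rw [resCocycle_apply, corCocycle_apply, corFun_coe]
  rfl

/-- **`cor ∘ res = 2`** (`= [G : N]`). On cocycles, the transfer of `f₀|_N` is
`2 f₀ + ∂(f₀(c))`. Serre, *Galois Cohomology*, I.§2.4, Prop. 9. [folklore] -/
theorem corH1_resSubgroupH1 (hN : IsOpen (N : Set G)) (hM : ∀ m : M, Continuous fun g : G ↦ g • m)
    (hc : ∀ b : G, Xor (b * c⁻¹ ∈ N) (b ∈ N)) (η : discreteH1 G M) :
    corH1 hN hM hc (resSubgroupH1 N M η) = 2 • η := by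
  obtain ⟨f, rfl⟩ := oneCocycleClass_surjective _ η
  rw [resSubgroupH1_oneCocycleClass, corH1_oneCocycleClass, two_nsmul, ← oneCocycleClass_add,
    ← add_zero (oneCocycleClass (discreteTopRep G M) (f + f)),
    ← oneCocycleClass_cobCocycle (f.1 c) (hM _), ← oneCocycleClass_add]
  congr 1
  apply Subtype.ext
  ext g
  rw [corCocycle_apply, add_apply_val, add_apply_val, cobCocycle_apply]
  -- the values of `f₀` at `c⁻¹ n c` and at `c²`
  have hconj : ∀ n : N, c • f.1 (c⁻¹ * n * c) = -f.1 c + f.1 n + (n : G) • f.1 c := fun n ↦ by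
    rw [cocycle_mul' f (c⁻¹ * n) c, cocycle_mul' f c⁻¹ n, cocycle_inv' f c]
    simp only [smul_add, smul_neg, smul_smul, mul_inv_cancel, one_smul, mul_inv_cancel_left]
  have hsym : ∀ n : N, (symCocycle c (resCocycle N f)).1 n = f.1 n + f.1 n + ((n : G) • f.1 c - f.1 c) :=
    fun n ↦ by
    rw [symCocycle_apply, resCocycle_apply, resCocycle_apply, subgroupConj_apply_coe, hconj]
    abel
  rcases exists_eq_or_eq_mul hc g with ⟨n, rfl⟩ | ⟨n, rfl⟩
  · rw [corFun_coe, hsym]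
  · rw [corFun_coe_mul, hsym, resCocycle_apply, cSq_coe, cocycle_mul' f (n : G) c,
      cocycle_mul' f c c]
    simp only [smul_add, smul_smul]
    abel

/-- The kernel of restriction is killed by `2 = [G : N]` (`cor ∘ res = 2`).
Serre, *Galois Cohomology*, I.§2.4, Cor. to Prop. 9. [folklore] -/
theorem two_nsmul_eq_zero_of_resSubgroupH1_eq_zero (hN : IsOpen (N : Set G))
    (hM : ∀ m : M, Continuous fun g : G ↦ g • m) (hc : ∀ b : G, Xor (b * c⁻¹ ∈ N) (b ∈ N))
    {η : discreteH1 G M} (hη : resSubgroupH1 N M η = 0) : 2 • η = 0 := by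
  rw [← corH1_resSubgroupH1 hN hM hc η, hη, map_zero]

end Transfer

/-! ## Twisting the coefficients by a character of `G/N` -/

section Twist

variable {N : Subgroup G} [N.Normal] {c : G}
variable {M : Type u} [AddCommGroup M] [DistribMulAction G M] [TopologicalSpace M]
  [DiscreteTopology M]
variable {M' : Type u} [AddCommGroup M'] [DistribMulAction G M'] [TopologicalSpace M']
  [DiscreteTopology M']

/-- **Anti-equivariance at `c` flips the sign of `c_*`.** Let `ψ : M' ≃ M` be additive,
`N`-equivariant, and anti-equivariant at `c` (`ψ (c • m') = -(c • ψ m')`: e.g. `M' = M ⊗ χ` for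
the quadratic character `χ` of `G/N`). Then the induced isomorphism `ψ_* : H¹(N, M') ≃ H¹(N, M)`
(`h1Equiv`) satisfies `ψ_* (c_* ξ') = -(c_* (ψ_* ξ'))`. (T. Dokchitser 2013, §4: the twist
`E_α ≅ E` over `K(√α)`.) [folklore] -/
theorem h1Equiv_conjH1_neg (ψ : M' ≃+ M) (hψ : ∀ (n : N) (m' : M'), ψ (n • m') = n • ψ m')
    (hψc : ∀ m' : M', ψ (c • m') = -(c • ψ m')) (ξ' : subgroupH1 N M') :
    h1Equiv ψ hψ (conjH1 N M' c ξ') = -conjH1 N M c (h1Equiv ψ hψ ξ') := by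
  obtain ⟨f, rfl⟩ := oneCocycleClass_surjective _ ξ'
  rw [conjH1_oneCocycleClass, h1Equiv_apply, h1Equiv_apply, resH1Hom_id_oneCocycleClass,
    resH1Hom_id_oneCocycleClass, conjH1_oneCocycleClass, ← oneCocycleClass_neg']
  congr 1
  apply Subtype.ext
  ext n
  rw [contOneCocycles.push_apply, conjCocycle_apply]
  change ψ (c • f.1 (subgroupConj N c n)) =
    -((conjCocycle N c (contOneCocycles.push (ψ : M' →+ M) hψ f)).1 n)
  rw [conjCocycle_apply, contOneCocycles.push_apply, hψc]
  rfl

end Twist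

/-! ## The `±`-decomposition up to bounded torsion -/

section Decomposition

variable {N : Subgroup G} [N.Normal] {c : G}
variable {M : Type u} [AddCommGroup M] [DistribMulAction G M] [TopologicalSpace M]
  [DiscreteTopology M]
variable {M' : Type u} [AddCommGroup M'] [DistribMulAction G M'] [TopologicalSpace M']
  [DiscreteTopology M']

/-- The data of the `±`-decomposition along the open normal index-`2` subgroup `N`: the modules
`M`, `M'` (interchanged by the character of `G/N` via `ψ`), and subgroups `S ≤ H¹(G, M)`,
`S' ≤ H¹(G, M')`, `T ≤ H¹(N, M)` (in the application: `Sel(E/ℚ)`, `Sel(E_d/ℚ)`, `Sel(E/K)`)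
with `res S ⊆ T`, `ψ_* res S' ⊆ T`, `c_* T ⊆ T`, and a torsion bound `2^a` on the defect of
"`res η ∈ T ⇒ η ∈ S`". [folklore] -/
structure IndexTwoDecompositionData (N : Subgroup G) [N.Normal] (c : G) (M M' : Type u)
    [AddCommGroup M] [DistribMulAction G M] [TopologicalSpace M] [DiscreteTopology M]
    [AddCommGroup M'] [DistribMulAction G M'] [TopologicalSpace M'] [DiscreteTopology M'] where
  /-- `N` is open. -/
  isOpen : IsOpen (N : Set G)
  /-- `G = N ⊔ N c`. -/
  xor : ∀ b : G, Xor (b * c⁻¹ ∈ N) (b ∈ N)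
  /-- continuity of the orbit maps of `M` -/
  continuous_smul : ∀ m : M, Continuous fun g : G ↦ g • m
  /-- continuity of the orbit maps of `M'` -/
  continuous_smul' : ∀ m' : M', Continuous fun g : G ↦ g • m'
  /-- the twisting isomorphism -/
  ψ : M' ≃+ M
  /-- `ψ` is `N`-equivariant -/
  hψ : ∀ (n : N) (m' : M'), ψ (n • m') = n • ψ m'
  /-- `ψ` is anti-equivariant at `c` -/
  hψc : ∀ m' : M', ψ (c • m') = -(c • ψ m')
  /-- `S ≤ H¹(G, M)` -/
  S : AddSubgroup (discreteH1 G M)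
  /-- `S' ≤ H¹(G, M')` -/
  S' : AddSubgroup (discreteH1 G M')
  /-- `T ≤ H¹(N, M)` -/
  T : AddSubgroup (subgroupH1 N M)
  /-- `res S ⊆ T` -/
  res_mem : ∀ η ∈ S, resSubgroupH1 N M η ∈ T
  /-- `ψ_* res S' ⊆ T` -/
  res_mem' : ∀ η' ∈ S', h1Equiv ψ hψ (resSubgroupH1 N M' η') ∈ T
  /-- `c_* T ⊆ T` -/
  conj_mem : ∀ ζ ∈ T, conjH1 N M c ζ ∈ T
  /-- the torsion exponent -/
  a : ℕ
  /-- `res η ∈ T ⇒ 2^a η ∈ S` -/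
  mem_of_res_mem : ∀ η, resSubgroupH1 N M η ∈ T → 2 ^ a • η ∈ S
  /-- `ψ_* res η' ∈ T ⇒ 2^a η' ∈ S'` -/
  mem_of_res_mem' : ∀ η', h1Equiv ψ hψ (resSubgroupH1 N M' η') ∈ T → 2 ^ a • η' ∈ S'

namespace IndexTwoDecompositionData

variable (D : IndexTwoDecompositionData N c M M')

/-- The comparison map `Φ : S × S' → T`, `(η, η') ↦ res η + ψ_* res η'`. [folklore] -/
def decompMap : D.S × D.S' →+ D.T :=
  (((resSubgroupH1 N M).comp D.S.subtype).coprod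
    (((h1Equiv D.ψ D.hψ : subgroupH1 N M' ≃+ subgroupH1 N M).toAddMonoidHom.comp
      (resSubgroupH1 N M')).comp D.S'.subtype)).codRestrict D.T (by
    rintro ⟨η, η'⟩
    exact D.T.add_mem (D.res_mem η η.2) (D.res_mem' η' η'.2))

/-- Values of `decompMap`. [folklore] -/
@[simp]
theorem coe_decompMap_apply (x : D.S × D.S') :
    (D.decompMap x : subgroupH1 N M) =
      resSubgroupH1 N M x.1 + h1Equiv D.ψ D.hψ (resSubgroupH1 N M' x.2) :=
  rfl

/-- `c_*` acts as `-1` on `ψ_* res H¹(G, M')` (anti-equivariance of `ψ` at `c` and triviality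
of `c_*` on restricted classes). [folklore] -/
theorem conjH1_h1Equiv_res (η' : discreteH1 G M') :
    conjH1 N M c (h1Equiv D.ψ D.hψ (resSubgroupH1 N M' η')) =
      -h1Equiv D.ψ D.hψ (resSubgroupH1 N M' η') := by
  have h := h1Equiv_conjH1_neg D.ψ D.hψ D.hψc (resSubgroupH1 N M' η')
  rw [conjH1_resSubgroupH1 N D.continuous_smul' c η'] at h
  exact (neg_eq_iff_eq_neg.mpr h).symm

/-- `c_*` acts as `-1` on `ψ_*⁻¹ res H¹(G, M)`. [folklore] -/
theorem conjH1_h1Equiv_symm_res (η : discreteH1 G M) :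
    conjH1 N M' c ((h1Equiv D.ψ D.hψ).symm (resSubgroupH1 N M η)) =
      -(h1Equiv D.ψ D.hψ).symm (resSubgroupH1 N M η) := by
  apply (h1Equiv D.ψ D.hψ).injective
  rw [h1Equiv_conjH1_neg D.ψ D.hψ D.hψc, AddEquiv.apply_symm_apply, map_neg,
    AddEquiv.apply_symm_apply, conjH1_resSubgroupH1 N D.continuous_smul c η]

/-- **The kernel of `Φ` is killed by `4`.** If `res η + ψ_* res η' = 0` then, with
`ξ = ψ_* res η' = -res η`, `c_* ξ = -ξ`, so `res (cor ξ) = ξ + c_* ξ = 0` and `2 cor ξ = 0`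
(`cor ∘ res = 2`); and `2 η = cor res η = -cor ξ`, whence `4 η = 0`. Symmetrically `4 η' = 0`.
(Dokchitser–Dokchitser 2010, proof of Lemma 4.14: "kernel killed by `|G|²`".)
[cite: DokchitserDokchitserAnnals2010, Lemma 4.14 (proof)] -/
theorem nsmul_eq_zero_of_decompMap_eq_zero (x : D.S × D.S') (hx : D.decompMap x = 0) :
    4 • x = 0 := by
  obtain ⟨⟨η, hη⟩, ⟨η', hη'⟩⟩ := x
  have h0 : resSubgroupH1 N M η + h1Equiv D.ψ D.hψ (resSubgroupH1 N M' η') = 0 :=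
    congrArg Subtype.val hx
  have hN := D.isOpen
  have hM := D.continuous_smul
  have hM' := D.continuous_smul'
  have hc := D.xor
  -- `η`
  have h4 : 4 • η = 0 := by
    set ξ := h1Equiv D.ψ D.hψ (resSubgroupH1 N M' η') with hξ
    have hres : resSubgroupH1 N M (corH1 hN hM hc ξ) = 0 := by
      rw [resSubgroupH1_corH1, hξ, D.conjH1_h1Equiv_res, add_neg_cancel]
    have h2cor : 2 • corH1 hN hM hc ξ = 0 :=
      two_nsmul_eq_zero_of_resSubgroupH1_eq_zero hN hM hc hres
    have h1 : resSubgroupH1 N M η = -ξ := eq_neg_of_add_eq_zero_left h0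
    have h2 : 2 • (2 • η) = 0 := by
      rw [← corH1_resSubgroupH1 hN hM hc η, h1, map_neg, smul_neg, h2cor, neg_zero]
    rwa [smul_smul] at h2
  -- `η'`
  have h4' : 4 • η' = 0 := by
    set ξ' := (h1Equiv D.ψ D.hψ).symm (resSubgroupH1 N M η) with hξ'
    have hres : resSubgroupH1 N M' (corH1 hN hM' hc ξ') = 0 := by
      rw [resSubgroupH1_corH1, hξ', D.conjH1_h1Equiv_symm_res, add_neg_cancel]
    have h2cor : 2 • corH1 hN hM' hc ξ' = 0 :=
      two_nsmul_eq_zero_of_resSubgroupH1_eq_zero hN hM' hc hres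
    have h1 : resSubgroupH1 N M' η' = -ξ' := by
      apply (h1Equiv D.ψ D.hψ).injective
      rw [map_neg, hξ', AddEquiv.apply_symm_apply]
      exact eq_neg_of_add_eq_zero_right h0
    have h2 : 2 • (2 • η') = 0 := by
      rw [← corH1_resSubgroupH1 hN hM' hc η', h1, map_neg, smul_neg, h2cor, neg_zero]
    rwa [smul_smul] at h2
  refine Prod.ext (Subtype.ext ?_) (Subtype.ext ?_)
  · simpa using h4
  · simpa using h4'

/-- **`2^(a+1) T ⊆ im Φ`.** For `ζ ∈ T`: `η = cor ζ` has `res η = ζ + c_* ζ ∈ T`, so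
`2^a η ∈ S`; `η' = cor ψ_*⁻¹ ζ` has `ψ_* res η' = ζ - c_* ζ ∈ T`, so `2^a η' ∈ S'`; and
`Φ(2^a η, 2^a η') = 2^a ((ζ + c_* ζ) + (ζ - c_* ζ)) = 2^(a+1) ζ`.
(Dokchitser–Dokchitser 2010, proof of Lemma 4.14: "cokernel killed by `|G|²`"; T. Dokchitser
2013, §4, display (Kalpha): `rk_p(E/K(√α)) = rk_p(E/K) + rk_p(E_α/K)`.)
[cite: DokchitserDokchitserAnnals2010, Lemma 4.14 (proof)] -/
theorem pow_nsmul_mem_range_decompMap (ζ : D.T) : 2 ^ (D.a + 1) • ζ ∈ D.decompMap.range := by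
  have hN := D.isOpen
  have hM := D.continuous_smul
  have hM' := D.continuous_smul'
  have hc := D.xor
  set z : subgroupH1 N M := (ζ : subgroupH1 N M) with hz
  -- the `+` part
  set η := corH1 hN hM hc z with hη
  have hres : resSubgroupH1 N M η = z + conjH1 N M c z := resSubgroupH1_corH1 hN hM hc z
  have hS : 2 ^ D.a • η ∈ D.S := D.mem_of_res_mem η (by
    rw [hres]; exact D.T.add_mem ζ.2 (D.conj_mem _ ζ.2))
  -- the `-` part
  set ξ' := (h1Equiv D.ψ D.hψ).symm z with hξ'
  set η' := corH1 hN hM' hc ξ' with hη'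
  have hres' : h1Equiv D.ψ D.hψ (resSubgroupH1 N M' η') = z - conjH1 N M c z := by
    rw [hη', resSubgroupH1_corH1, map_add, h1Equiv_conjH1_neg D.ψ D.hψ D.hψc, hξ',
      AddEquiv.apply_symm_apply, sub_eq_add_neg]
  have hS' : 2 ^ D.a • η' ∈ D.S' := D.mem_of_res_mem' η' (by
    rw [hres']; exact D.T.sub_mem ζ.2 (D.conj_mem _ ζ.2))
  refine ⟨(⟨_, hS⟩, ⟨_, hS'⟩), Subtype.ext ?_⟩
  rw [coe_decompMap_apply]
  change resSubgroupH1 N M (2 ^ D.a • η) + h1Equiv D.ψ D.hψ (resSubgroupH1 N M' (2 ^ D.a • η')) =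
    ((2 ^ (D.a + 1) • ζ : D.T) : subgroupH1 N M)
  rw [map_nsmul, map_nsmul, map_nsmul, hres, hres', AddSubmonoidClass.coe_nsmul, ← hz,
    ← smul_add, pow_succ, ← smul_smul, two_nsmul]
  congr 1
  abel

end IndexTwoDecompositionData

end Decomposition

end Literature.NumberTheory.EllipticCurves
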